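import Literature.MathematicalPhysics.QuantumFieldTheory.Balaban1983to89.BlockAveragingEMLLinearisedBackground
import Summits.QuantumFields.YangMills.Theorems.UnitScaleTiltProp7AvgTrueLinearisationDiff
import HarnessLib

/-!
# Route `UnitScaleTilt`, crux K1 «MinimiserStabilityRegPr» (stmt-QuantumFields-19200), route-R [RP] at a curved background ∕ (α) (AVG-SYM) operator junction —
# THE CURVED N6, FIRST BRICK (one step): THE STRUCTURE OF THE TRUE LINEARISED (0.4)-AVERAGE AT A BACKGROUND `U₀`,
# `Q₁^{R₀}(U₀)Y(c) = CM(y) + LINE(c) − R(Ū₀(c))·CM′(y′) + D(c)`, `‖D(c)‖ ≤ 2α·|I|⁻¹Σ_i Σ_{s ∈ Γ^{σ′_i}} ‖Y(s)‖`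

Cell `ym3-torus`, width seat `ym-ust-20520-w2` (g2); typed per ★★OWNER g25 03:26:35Z («type its first algebraic brick regardless of the 03:50Z re-aim»), following this
seat's LOCATED notes `S2-CURVED-LOCATED-w2g2.md` ∕ `CURVED-N6-LOCATED-w2g2.md` (19200 evidence) and feeding the displayed rows of ✓ p601741
`…Prop7CurvedLandauCoercivity.sum_normSq_le_curl_sq_of_landau_of_structure_T3`.  THEOREMS ONLY (0 `def`, 0 `sorry`); `--supports stmt-QuantumFields-19200`,
count-neutral.  YM₃ on T³ is a ladder rung (R3), not the Clay problem; nothing here claims the curved N6, S2, P, the crux or the gap.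

THE LETTERS (tree: `BlockAveragingEMLLinearisedBackground`, [Balaban1985Averaging] Prop. 3 (121)–(125) at a background).  `covLinAvgR0 U₀ Y c` = print's `Q₁^{R₀}(U₀)Y`
= `|I|⁻¹Σ_i [comb_i + A₀,i·line_i·A₀,i* − T_i·comb′_i·T_i*]` with `comb_i = Y_{U₀}(Γ^{σ_i}_{y→x_i})` (covariant comb sum from `emb c₋`), `line_i = Y_{U₀}([x_i, x_i′])`
(covariant straight sum), `comb′_i = Y_{U₀}(Γ^{σ′_i}_{y′→x_i′})`, `A₀,i` the background comb holonomy and `T_i = A₀,iB₀,iC₀,i⁻¹ = W⁰_i·Ū₀(c)` (`BlockAveragingEMLProp2.loopHol_eq`: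
`W⁰_i = loopHol U₀ c i`, `Ū₀(c) = axialAvg U₀ c` the straight coarse bond of the background).

WHAT IS PROVED (ns `…Theorems.Prop7CovLinAvgStructureStep`).
* §1 the `ℓ¹` bound `‖Y_{U₀}(Γ)‖ ≤ Σ_{s∈Γ} ‖Y(s.bond)‖` is the tree's `Prop7HolRatioPerStep.norm_covWalkSum_le_mass` (★p1 g4), used by name.
* §2 `covLinAvgR0_eq_three_means` — `Q₁^{R₀} = |I|⁻¹Σ comb + |I|⁻¹Σ A₀·line·A₀* − |I|⁻¹Σ T·comb′·T*` (the three means separated).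
* §3 `norm_conj_mul_sub_conj_le` — `‖(Wa)X(Wa)* − aXa*‖ ≤ 2‖W − 1‖·‖X‖` for special-unitary `W`, `a`.
* §4 ★★ `norm_covLinAvgR0_sub_structure_le` — with `dist1(W⁰_i) ≤ α` for all `i`:
  `‖Q₁^{R₀}(U₀)Y(c) − (|I|⁻¹Σ_i comb_i + |I|⁻¹Σ_i A₀,i line_i A₀,i* − Ū₀(c)·(|I|⁻¹Σ_i comb′_i)·Ū₀(c)*)‖ ≤ 2α·|I|⁻¹Σ_i Σ_{s∈walk(emb c₊)(Γ^{σ′_i})} ‖Y(s.bond)‖`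
  — the one-step structure: comb mean at `y` (the linearised coarse gauge function `v(y)`, [B7] (62)–(63)), the comb-transported covariant straight-line mean (the engine's
  `A^{U₀}` summand up to the comb convention), MINUS the coarse-bond-transported comb mean at `y′`, up to a defect linear in `Y` with coefficient `2α` (the background's
  (0.4) loop variables) — the `j = 1` case of row (R-A) of `CURVED-N6-LOCATED-w2g2.md`, defect shape of row (R-C).
HONEST SCOPE.  One step, algebra and the triangle inequality; the `k`-fold recursion (`Λ_{j+1} = L^j·CM^{(j)} + R(·)Λ_j∘emb`), its `(H¹)^*`-bound and the level sum are not here.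

References: T. Bałaban, CMP 98 (1985) 17–51 [Balaban1985Averaging] (Prop. 3 (121)–(125) p.36, (56)–(58) p.27, (62)–(63) p.28); CMP 109 (1987) 249–301 [Balaban1987RG1] ((0.4) p.253).
-/

noncomputable section

open scoped BigOperators Matrix.Norms.L2Operator

namespace Summit.QuantumFields.YangMills.Theorems.Prop7CovLinAvgStructureStep

open Literature.MathematicalPhysics.QuantumFieldTheory.Balaban1983to89
open Finset T4Continuum BlockAveraging AveragingRT ExpMeanLog BlockAveragingEMLLinearised BlockAveragingEMLLinearisedBackground BlockAveragingEMLProp2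
open Summit.QuantumFields.YangMills.Theorems.Prop7HolRatioPerStep (norm_coe_eq_one norm_star_coe_eq_one norm_covWalkSum_le_mass)

variable {P : Params} {n : Type*} [Fintype n] [DecidableEq n] [Nonempty n] {j : ℕ}

/-! ## §1 (the `ℓ¹` bound `‖Y_{U₀}(Γ)‖ ≤ Σ_{s∈Γ}‖Y(s.bond)‖` is the tree's `Prop7HolRatioPerStep.norm_covWalkSum_le_mass`) -/

/-! ## §2 The three means of the `R₀` form -/

/-- `Q₁^{R₀}(U₀)Y(c)` split into its three means. [cite: Balaban1985Averaging, (124)-(125) p.36] -/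
theorem covLinAvgR0_eq_three_means (U₀ : GaugeField P j (Matrix.specialUnitaryGroup n ℂ)) (Y : PBond P j → Matrix n n ℂ) (c : PBond P (j + 1)) :
    covLinAvgR0 U₀ Y c
      = ((Fintype.card (Idx P) : ℂ))⁻¹ • ∑ i : Idx P, covWalkSum U₀ Y (walk (emb c.src) (stairWord i.2.1 (off i.1)))
        + ((Fintype.card (Idx P) : ℂ))⁻¹ • ∑ i : Idx P,
            ((holAt U₀ (walk (emb c.src) (stairWord i.2.1 (off i.1))) : Matrix.specialUnitaryGroup n ℂ) : Matrix n n ℂ) *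
              covWalkSum U₀ Y (walk (walkEnd (emb c.src) (stairWord i.2.1 (off i.1))) (List.replicate P.L (c.dir, true))) *
            star ((holAt U₀ (walk (emb c.src) (stairWord i.2.1 (off i.1))) : Matrix.specialUnitaryGroup n ℂ) : Matrix n n ℂ)
        - ((Fintype.card (Idx P) : ℂ))⁻¹ • ∑ i : Idx P,
            ((holAt U₀ (walk (emb c.src) (stairWord i.2.1 (off i.1))) *
                  holAt U₀ (walk (walkEnd (emb c.src) (stairWord i.2.1 (off i.1))) (List.replicate P.L (c.dir, true))) *
                  (holAt U₀ (walk (emb c.tgt) (stairWord i.2.2 (off i.1))))⁻¹ : Matrix.specialUnitaryGroup n ℂ) : Matrix n n ℂ) *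
              covWalkSum U₀ Y (walk (emb c.tgt) (stairWord i.2.2 (off i.1))) *
            star ((holAt U₀ (walk (emb c.src) (stairWord i.2.1 (off i.1))) *
                  holAt U₀ (walk (walkEnd (emb c.src) (stairWord i.2.1 (off i.1))) (List.replicate P.L (c.dir, true))) *
                  (holAt U₀ (walk (emb c.tgt) (stairWord i.2.2 (off i.1))))⁻¹ : Matrix.specialUnitaryGroup n ℂ) : Matrix n n ℂ) := by
  rw [covLinAvgR0, ← smul_add, ← smul_sub, ← Finset.sum_add_distrib, ← Finset.sum_sub_distrib]

/-! ## §3 Conjugation by a product with a near-identity unitary -/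

/-- `‖(Wa)·X·(Wa)* − a·X·a*‖ ≤ 2‖W − 1‖·‖X‖` for special-unitary `W`, `a` (the outer conjugation by `W` moves `aXa*` by at most `2‖W − 1‖` times its norm). [folklore] -/
theorem norm_conj_mul_sub_conj_le (W a : Matrix.specialUnitaryGroup n ℂ) (X : Matrix n n ℂ) :
    ‖((W * a : Matrix.specialUnitaryGroup n ℂ) : Matrix n n ℂ) * X * star ((W * a : Matrix.specialUnitaryGroup n ℂ) : Matrix n n ℂ)
        - (a : Matrix n n ℂ) * X * star (a : Matrix n n ℂ)‖
      ≤ 2 * ‖(W : Matrix n n ℂ) - 1‖ * ‖X‖ := by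
  set Z : Matrix n n ℂ := (a : Matrix n n ℂ) * X * star (a : Matrix n n ℂ) with hZ
  have hZn : ‖Z‖ ≤ ‖X‖ := by
    calc ‖Z‖ ≤ ‖(a : Matrix n n ℂ)‖ * ‖X‖ * ‖star (a : Matrix n n ℂ)‖ :=
          (norm_mul_le _ _).trans (mul_le_mul_of_nonneg_right (norm_mul_le _ _) (norm_nonneg _))
      _ = ‖X‖ := by rw [norm_coe_eq_one, norm_star_coe_eq_one, one_mul, mul_one]
  have e : ((W * a : Matrix.specialUnitaryGroup n ℂ) : Matrix n n ℂ) * X * star ((W * a : Matrix.specialUnitaryGroup n ℂ) : Matrix n n ℂ) - Z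
      = ((W : Matrix n n ℂ) - 1) * Z * star (W : Matrix n n ℂ) + Z * (star (W : Matrix n n ℂ) - 1) := by
    simp only [hZ, Submonoid.coe_mul, star_mul]
    noncomm_ring
  rw [e]
  have hWs : ‖star (W : Matrix n n ℂ)‖ = 1 := norm_star_coe_eq_one W
  have hWs1 : ‖star (W : Matrix n n ℂ) - 1‖ = ‖(W : Matrix n n ℂ) - 1‖ := by
    rw [← norm_star (star (W : Matrix n n ℂ) - 1), star_sub, star_star, star_one]
  calc ‖((W : Matrix n n ℂ) - 1) * Z * star (W : Matrix n n ℂ) + Z * (star (W : Matrix n n ℂ) - 1)‖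
      ≤ ‖((W : Matrix n n ℂ) - 1) * Z * star (W : Matrix n n ℂ)‖ + ‖Z * (star (W : Matrix n n ℂ) - 1)‖ := norm_add_le _ _
    _ ≤ ‖(W : Matrix n n ℂ) - 1‖ * ‖Z‖ * ‖star (W : Matrix n n ℂ)‖ + ‖Z‖ * ‖star (W : Matrix n n ℂ) - 1‖ :=
        add_le_add ((norm_mul_le _ _).trans (mul_le_mul_of_nonneg_right (norm_mul_le _ _) (norm_nonneg _))) (norm_mul_le _ _)
    _ = ‖(W : Matrix n n ℂ) - 1‖ * ‖Z‖ + ‖Z‖ * ‖(W : Matrix n n ℂ) - 1‖ := by rw [hWs, hWs1, mul_one]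
    _ ≤ 2 * ‖(W : Matrix n n ℂ) - 1‖ * ‖X‖ := by nlinarith [norm_nonneg ((W : Matrix n n ℂ) - 1)]

/-! ## §4 ★★ The one-step structure of the true linearised average at `U₀` -/

/-- ★★ **THE ONE-STEP STRUCTURE OF `Q₁^{R₀}(U₀)`**: if the background's (0.4) loop variables at the coarse bond `c` are within `α` of `1`, then
`‖Q₁^{R₀}(U₀)Y(c) − (CM(c₋) + LINE(c) − Ū₀(c)·CM′(c₊)·Ū₀(c)*)‖ ≤ 2α·|I|⁻¹·Σ_i Σ_{s ∈ walk(emb c₊)(Γ^{σ′_i})} ‖Y(s.bond)‖`, where `CM(c₋) = |I|⁻¹Σ_i Y_{U₀}(Γ^{σ_i}_{y→x_i})`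
(covariant comb mean at `y`), `LINE(c) = |I|⁻¹Σ_i A₀,i·Y_{U₀}([x_i,x_i′])·A₀,i*` (comb-transported covariant straight-line mean), `CM′(c₊) = |I|⁻¹Σ_i Y_{U₀}(Γ^{σ′_i}_{y′→x_i′})` and
`Ū₀(c) = axialAvg U₀ c` — all written out.  The `T_i = W⁰_i·Ū₀(c)` factorisation is `BlockAveragingEMLProp2.loopHol_eq`. [cite: Balaban1985Averaging, Prop. 3 (124)-(125) p.36] -/
theorem norm_covLinAvgR0_sub_structure_le (U₀ : GaugeField P j (Matrix.specialUnitaryGroup n ℂ)) (Y : PBond P j → Matrix n n ℂ) (c : PBond P (j + 1))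
    {α : ℝ} (hα : ∀ i : Idx P, dist1 (loopHol U₀ c i) ≤ α) :
    ‖covLinAvgR0 U₀ Y c
        - (((Fintype.card (Idx P) : ℂ))⁻¹ • ∑ i : Idx P, covWalkSum U₀ Y (walk (emb c.src) (stairWord i.2.1 (off i.1)))
          + ((Fintype.card (Idx P) : ℂ))⁻¹ • ∑ i : Idx P,
              ((holAt U₀ (walk (emb c.src) (stairWord i.2.1 (off i.1))) : Matrix.specialUnitaryGroup n ℂ) : Matrix n n ℂ) *
                covWalkSum U₀ Y (walk (walkEnd (emb c.src) (stairWord i.2.1 (off i.1))) (List.replicate P.L (c.dir, true))) *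
              star ((holAt U₀ (walk (emb c.src) (stairWord i.2.1 (off i.1))) : Matrix.specialUnitaryGroup n ℂ) : Matrix n n ℂ)
          - ((axialAvg U₀ c : Matrix.specialUnitaryGroup n ℂ) : Matrix n n ℂ) *
              (((Fintype.card (Idx P) : ℂ))⁻¹ • ∑ i : Idx P, covWalkSum U₀ Y (walk (emb c.tgt) (stairWord i.2.2 (off i.1)))) *
            star ((axialAvg U₀ c : Matrix.specialUnitaryGroup n ℂ) : Matrix n n ℂ))‖
      ≤ 2 * α * (((Fintype.card (Idx P) : ℝ))⁻¹ * ∑ i : Idx P,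
          ((walk (emb c.tgt) (stairWord i.2.2 (off i.1))).map fun s => ‖Y s.bond‖).sum) := by
  classical
  have hI : (0 : ℝ) < (Fintype.card (Idx P) : ℝ) := by exact_mod_cast Fintype.card_pos
  have hα0 : 0 ≤ α := (GaugeGroup.dist1_nonneg _).trans (hα (Classical.arbitrary (Idx P)))
  -- abbreviations for the comb′ sums and the transports
  set cm' : Idx P → Matrix n n ℂ := fun i => covWalkSum U₀ Y (walk (emb c.tgt) (stairWord i.2.2 (off i.1))) with hcm'
  set T : Idx P → Matrix.specialUnitaryGroup n ℂ := fun i =>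
    holAt U₀ (walk (emb c.src) (stairWord i.2.1 (off i.1))) *
      holAt U₀ (walk (walkEnd (emb c.src) (stairWord i.2.1 (off i.1))) (List.replicate P.L (c.dir, true))) *
      (holAt U₀ (walk (emb c.tgt) (stairWord i.2.2 (off i.1))))⁻¹ with hT
  set a : Matrix.specialUnitaryGroup n ℂ := axialAvg U₀ c with ha
  -- `T_i = W⁰_i · a`
  have hTW : ∀ i, T i = loopHol U₀ c i * a := by
    intro i
    rw [loopHol_eq, hT, ha, inv_mul_cancel_right]
  -- the difference is the mean of the conjugation defects of the comb′ terms
  have hdiff : covLinAvgR0 U₀ Y c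
        - (((Fintype.card (Idx P) : ℂ))⁻¹ • ∑ i : Idx P, covWalkSum U₀ Y (walk (emb c.src) (stairWord i.2.1 (off i.1)))
          + ((Fintype.card (Idx P) : ℂ))⁻¹ • ∑ i : Idx P,
              ((holAt U₀ (walk (emb c.src) (stairWord i.2.1 (off i.1))) : Matrix.specialUnitaryGroup n ℂ) : Matrix n n ℂ) *
                covWalkSum U₀ Y (walk (walkEnd (emb c.src) (stairWord i.2.1 (off i.1))) (List.replicate P.L (c.dir, true))) *
              star ((holAt U₀ (walk (emb c.src) (stairWord i.2.1 (off i.1))) : Matrix.specialUnitaryGroup n ℂ) : Matrix n n ℂ)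
          - (a : Matrix n n ℂ) * (((Fintype.card (Idx P) : ℂ))⁻¹ • ∑ i : Idx P, cm' i) * star (a : Matrix n n ℂ))
      = -(((Fintype.card (Idx P) : ℂ))⁻¹ • ∑ i : Idx P,
          (((T i : Matrix.specialUnitaryGroup n ℂ) : Matrix n n ℂ) * cm' i * star ((T i : Matrix.specialUnitaryGroup n ℂ) : Matrix n n ℂ)
            - (a : Matrix n n ℂ) * cm' i * star (a : Matrix n n ℂ))) := by
    rw [covLinAvgR0_eq_three_means]
    simp only [hcm', hT, Finset.sum_sub_distrib, smul_sub, Finset.mul_sum, Finset.sum_mul, Finset.smul_sum, Matrix.mul_smul, Matrix.smul_mul]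
    abel
  rw [hdiff, norm_neg]
  -- norm of the mean ≤ mean of the norms ≤ mean of `2α‖cm′_i‖`
  calc ‖((Fintype.card (Idx P) : ℂ))⁻¹ • ∑ i : Idx P,
          (((T i : Matrix.specialUnitaryGroup n ℂ) : Matrix n n ℂ) * cm' i * star ((T i : Matrix.specialUnitaryGroup n ℂ) : Matrix n n ℂ)
            - (a : Matrix n n ℂ) * cm' i * star (a : Matrix n n ℂ))‖
      ≤ ((Fintype.card (Idx P) : ℝ))⁻¹ * ∑ i : Idx P,
          ‖((T i : Matrix.specialUnitaryGroup n ℂ) : Matrix n n ℂ) * cm' i * star ((T i : Matrix.specialUnitaryGroup n ℂ) : Matrix n n ℂ)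
            - (a : Matrix n n ℂ) * cm' i * star (a : Matrix n n ℂ)‖ := by
        rw [norm_smul, norm_inv, Complex.norm_natCast]
        exact mul_le_mul_of_nonneg_left (norm_sum_le _ _) (by positivity)
    _ ≤ ((Fintype.card (Idx P) : ℝ))⁻¹ * ∑ i : Idx P, (2 * α * ((walk (emb c.tgt) (stairWord i.2.2 (off i.1))).map fun s => ‖Y s.bond‖).sum) := by
        refine mul_le_mul_of_nonneg_left (Finset.sum_le_sum fun i _ => ?_) (by positivity)
        rw [hTW i]
        have h1 := norm_conj_mul_sub_conj_le (loopHol U₀ c i) a (cm' i)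
        have hW1 : ‖((loopHol U₀ c i : Matrix.specialUnitaryGroup n ℂ) : Matrix n n ℂ) - 1‖ ≤ α := by
          rw [← FederbushMean.dist1_SU_eq]; exact hα i
        have hcm : ‖cm' i‖ ≤ ((walk (emb c.tgt) (stairWord i.2.2 (off i.1))).map fun s => ‖Y s.bond‖).sum := norm_covWalkSum_le_mass U₀ Y _
        have h0 : 0 ≤ ‖cm' i‖ := norm_nonneg _
        calc _ ≤ 2 * ‖((loopHol U₀ c i : Matrix.specialUnitaryGroup n ℂ) : Matrix n n ℂ) - 1‖ * ‖cm' i‖ := h1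
          _ ≤ 2 * α * ((walk (emb c.tgt) (stairWord i.2.2 (off i.1))).map fun s => ‖Y s.bond‖).sum := by
              refine mul_le_mul (mul_le_mul_of_nonneg_left hW1 (by norm_num)) hcm h0 (by positivity)
    _ = 2 * α * (((Fintype.card (Idx P) : ℝ))⁻¹ * ∑ i : Idx P, ((walk (emb c.tgt) (stairWord i.2.2 (off i.1))).map fun s => ‖Y s.bond‖).sum) := by
        rw [← Finset.mul_sum]; ring

end Summit.QuantumFields.YangMills.Theorems.Prop7CovLinAvgStructureStep

end
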